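import Literature.MathematicalPhysics.QuantumFieldTheory.Balaban1983to89.Node00.Record13LettersOfThm1CCMWZB
import Literature.MathematicalPhysics.QuantumFieldTheory.Balaban1983to89.Node00.U3KernelLetters2
import Summits.QuantumFields.YangMills.Theorems.BalabanUVNodesD4KernelDecayOfWindowed
import Summits.QuantumFields.YangMills.Theorems.BalabanUVNodesN18UniformDecayOfStepRate

/-!
# K0⁷ V23 — NODE O's BOX SUPPLIERS RE-HOMED ON THE V23 ROAD (residue-free, route-independent): one-constant (5.10) decay of the limiting kernels over a window ∕ the K3-side kernel
# letters (NE9 with fading memory + the (D4) clause) ∕ W1's three windowed letters of record ⟹ the sign-free |β| box of the record's β-functions (θ-generic), and, AT THE PRINT-REGIME Z3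
# MEMBERS `θ₁₃ᶜᶜᴹᵂᶻᴮ(j; γ₀; εbg := a₀)`, ⟹ THE TOKEN-FREE CORE of the V23 stub-3ᴬ′ᴮ text (the hypothesis `box` of ✓p769914 `K0V23Stub3Sockets.absBetaBoxGZBAt_of_tokenFreeZB ∕ k0Body_of_tokenFreeZB_byName`)

Cell `pub-ymgap`, width seat `pub-ymgap-dag-n07-w3` (g16; N07 [B11] ∕ K0⁷ junction).  `--kind proof --supports stmt-QuantumFields-20541 --as helper`, COUNT-NEUTRAL.  NEW leaf; theorems
only — 0 `def`, 0 `sorry`.  Imports ONLY green, residue-free, route-independent modules: DEF-1's `Node00/Record13LettersOfThm1CCMWZB` (the Z3 members + the window ∕ half-window β transfer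
`betaLowerH_half_of_theta13OfThm1CCMWZB`), W1-19c's `Node00/U3KernelLetters2` (`WindowedDecayUniformOfRecord₁₃`; through it W1-19b `U3KernelLetters`: `PolLimitsExistOfRecord₁₃`, `WindowedNE9OfRecord₁₃`,
`WindowedDecayOfRecord₁₃`, and W1-19 `U3OfKernels`: `kernelA`, `EA`, `objectsOfRecord₁₃`, `KernelDecayOfRecord₁₃`) n22-w3's `Thm/BalabanUVNodesD4KernelDecayOfWindowed` (`decay510_kernelA_of_windowed`, `kernelDecayOfRecord₁₃_of_windowed`; through it `…N22AtU3OfKernels`: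
`ne9_EA_of_windowed`) and dag-n18-w4's `Thm/BalabanUVNodesN18UniformDecayOfStepRate` (`windowedDecayUniformOfRecord₁₃_of_windowedStepRateOfRecord₁₃_of_base`: node N18's step-rate
letter + the level-0 row ⟹ W1-19c's uniform windowed letter).  [I] = [Balaban1987RG1]; [II] = [Balaban1989LargeFieldII]; [RG2] = [Balaban1988RG2Cluster]; [15] = [Balaban1985Variational]; [III] = [Balaban1988Convergent].

WHY.  The stub-3 lane's θ-generic box suppliers — k0-s3-w1's `…K0Stub3RunwiseSuppliers` §3 (`absBetaBox_of_kernelDecayWindowUniform`: ONE-constant (5.10) decay of W1-19's limiting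
kernels over `]0, γ₀]^ℕ` ⟹ `|β₁₃(θ)| ≤ β′₅₁₀` on `]0, γ₀]^{k+1}`) and `…K0Stub3BoxOfKernelLetters` §1–§2 (N22's kernel NE9 with node-U3 fading memory transports the (D4) per-sequence constant to
ONE constant; W1's three windowed letters ⟹ the box) — import `…K0V19Stub2Prime` ∕ `…K2NamedJetsRunRemAt`-era modules and are on node00-def-R's §RESIDUE list (`residue_v6.txt` rows 25–40:
ALL sixteen `…K0Stub3*`): after today's Stage-2 seam they do not build and go to the R556 attic, and with them NODE O's only typed roads from kernel letters to a β-box.  The V23 road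
(`K0V23Defs` ✓p767853 → skeleton V23 → stub 3ᴬ′ᴮ `∀ F, K0V23Defs.AbsBetaBoxAtThm1WitnessCCMGenGridGZBAt F`) needs exactly those roads, keyed at the print-regime Z3 member `εbg := a₀` and ending
in the TOKEN-FREE CORE «∀ a₀ > 0, ∃ γ₀ ε₂₉ β′, box of β₁₃(F; a₀, ε₂₉) on ]0, γ₀]» (✓p769914).  THIS FILE re-homes them: §1 private verbatim helpers (№366 R2), §2 the θ-generic suppliers as
NEW public statements (|·|-form with the explicit constant `β′₅₁₀`; ∃-forms with `0 ≤ β′`) PLUS the two-letter road W1-19c `WindowedDecayUniformOfRecord₁₃` +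
`PolLimitsExistOfRecord₁₃` ⟹ box (the letter node N18's `windowedDecayUniformOfRecord₁₃_of_windowedStepRateOfRecord₁₃_of_base` produces), §3 the suppliers AT THE Z3 MEMBERS concluding the token-free core verbatim — window edition
included: a box of the `γ₀`-WINDOW member `θ₁₃ᶜᶜᴹᵂᶻᴮ(j; γ₀; a₀; …)` on `]0, γ₀]`, `γ₀ ≤ ½`, IS a box of the half-window member there (DEF-1's transfer), which is what the core asks.

HONEST FRAMING (binding).  Elementary real bookkeeping (|Σ_z Π(z) z₀z₁| under (5.10); triangle inequality; geometric row sums) + by-name composition over LANDED green modules; NOTHING of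
Bałaban's analysis is asserted or proved: the one-constant (5.10) decay of the record's limiting kernels, kernel-currency NE9 with fading memory, the (D4) clause, the existence of the
(1.21) limits and the windowed bounds are HYPOTHESES (NODE O ∕ N22 ∕ (D4) desks' letters; [I] §1 p.264 «uniformly bounded» STATED, proof unpublished [II] p.355; NE9 in kernel currency is NOT
printed for d = 4) — inhabited nowhere here; the token-free core ∕ stub 3ᴬ′ᴮ NOT proved; V23 NOT registered; K0⁷ stmt-QuantumFields-20541 NOT closed; N07 NOT discharged; K1⁹ ∕ K3⁸ OPEN;
counts UNMOVED (typed 28∕28 · discharged 8∕28, route display 8∕27 excl. NODE O; K 1∕4); R4 = the CONDITIONAL finite-𝕋⁴ rung `BalabanLadder.UV` at fixed `ε = L^(−K)` only — NOT continuum ∕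
ℝ⁴ ∕ OS; the Yang–Mills mass gap (Clay) is NOT proved by any of this.  Standard axioms only.
-/

noncomputable section

open scoped Matrix.Norms.L2Operator BigOperators
open Filter Topology Finset

namespace Summit.QuantumFields.YangMills.Theorems.K0V23Stub3BoxSuppliers

open Literature.MathematicalPhysics.QuantumFieldTheory.Balaban1983to89
open Literature.MathematicalPhysics.QuantumFieldTheory.Balaban1983to89.Node00
open Literature.MathematicalPhysics.QuantumFieldTheory.Balaban1983to89.T4Continuum
open Literature.MathematicalPhysics.QuantumFieldTheory.Balaban1983to89.FlowStep
open Literature.MathematicalPhysics.QuantumFieldTheory.Balaban1983to89.T4OutputRate (Window NE9 FadingMemory)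
open Literature.MathematicalPhysics.QuantumFieldTheory.Balaban1983to89.T4FlagMemory (extd)
open Literature.MathematicalPhysics.QuantumFieldTheory.Balaban1983to89.T4BetaReadOut (extd_mem_window)
open Literature.MathematicalPhysics.QuantumFieldTheory.Balaban1983to89.B12Sec2to5 (l1 Decay510 betaPrime510 secondMoment_abs_le_of_decay510)
open Literature.MathematicalPhysics.QuantumFieldTheory.Balaban1983to89.Node00.U3OfKernels (histPrefix kernelA EA ne9_EA_iff objectsOfRecord₁₃ KernelDecayOfRecord₁₃)
open Literature.MathematicalPhysics.QuantumFieldTheory.Balaban1983to89.Node00.U3KernelLetters (PolLimitsExistOfRecord₁₃ polLimitsExistOfRecord₁₃_iff WindowedNE9OfRecord₁₃ WindowedDecayOfRecord₁₃)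
open Literature.MathematicalPhysics.QuantumFieldTheory.Balaban1983to89.Node00.U3KernelLetters2 (WindowedDecayUniformOfRecord₁₃)
open Literature.MathematicalPhysics.QuantumFieldTheory.Balaban1983to89.Node00.U3KernelLetters (WindowedStepRateOfRecord₁₃)
open YMDAG.N22.AtKernels (decay510_kernelA_of_windowed ne9_EA_of_windowed kernelDecayOfRecord₁₃_of_windowed)
open YMDAG.N18.UniformDecayOfStepRate (windowedDecayUniformOfRecord₁₃_of_windowedStepRateOfRecord₁₃_of_base)

/-! ## §1  Private helpers (verbatim re-homes of residue statements; №366 R2) -/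

section Helpers

/-- FADING MEMORY ⟹ k-SUMMABLE ROWS: `0 ≤ Λ a i ≤ C₉·ω^{a−i}`, `0 ≤ ω < 1` ⟹ `Σ_{i ≤ k} Λ (k+1) i ≤ C₉∕(1 − ω)`. [folklore] -/
private theorem rowSum_le_of_fadingMemory {C₉ ω : ℝ} {Λ : ℕ → ℕ → ℝ} (h : FadingMemory C₉ ω Λ) (hω0 : 0 ≤ ω) (hω1 : ω < 1) (k : ℕ) :
    ∑ i ∈ range (k + 1), Λ (k + 1) i ≤ C₉ / (1 - ω) := by
  have hC : 0 ≤ C₉ := by have := h 0 0 le_rfl; simpa using this.1.trans this.2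
  have h1 : ∑ i ∈ range (k + 1), Λ (k + 1) i ≤ ∑ i ∈ range (k + 1), C₉ * ω ^ (k - i) := by
    refine Finset.sum_le_sum fun i hi => ?_
    have h2 := (h (k + 1) i (by have := Finset.mem_range.mp hi; omega)).2
    have h3 : ω ^ (k + 1 - i) ≤ ω ^ (k - i) := by
      rw [show k + 1 - i = (k - i) + 1 by have := Finset.mem_range.mp hi; omega, pow_succ]
      exact mul_le_of_le_one_right (pow_nonneg hω0 _) hω1.le
    exact h2.trans (mul_le_mul_of_nonneg_left h3 hC)
  have h2 : ∑ i ∈ range (k + 1), C₉ * ω ^ (k - i) = C₉ * ∑ j ∈ range (k + 1), ω ^ j := by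
    rw [← Finset.mul_sum, ← Finset.sum_range_reflect (fun j => ω ^ j) (k + 1)]
    congr 1
  have h3 : ∑ j ∈ range (k + 1), ω ^ j ≤ 1 / (1 - ω) := by
    have := geom_sum_Ico_le_of_lt_one (m := 0) (n := k + 1) hω0 hω1
    rw [pow_zero, ← Finset.range_eq_Ico] at this
    exact this
  calc ∑ i ∈ range (k + 1), Λ (k + 1) i ≤ C₉ * ∑ j ∈ range (k + 1), ω ^ j := h1.trans_eq h2
    _ ≤ C₉ * (1 / (1 - ω)) := mul_le_mul_of_nonneg_left h3 hC
    _ = C₉ / (1 - ω) := by ring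

variable {𝔄 : Type*} [NormedRing 𝔄] [NormedAlgebra ℝ 𝔄]
variable {V : Type*} [NormedAddCommGroup V] [NormedSpace ℝ V] {ι : Type*} [Fintype ι]
variable (F : T4Family) (ℰ : TermFamily1 F 𝔄) (ρ : V →L[ℝ] 𝔄) (bV : Module.Basis ι ℝ V)

/-- NE9 (kernel currency) with rows summing to `≤ S` transports (5.10) from ONE window sequence to ALL window sequences with the constant `C + γ·S`. [cite: Balaban1987RG1, (5.10) p.293, §5 p.298 (bookkeeping)] -/
private theorem decayUniform_of_ne9_of_decayAt {γ κ C S : ℝ} {Λ : ℕ → ℕ → ℝ} {μ ν : Fin 4} (hγ : 0 ≤ γ) (h9 : NE9 (EA F ℰ ρ bV) (Window γ) κ Λ)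
    (hΛ : ∀ k, ∀ i ∈ range (k + 1), 0 ≤ Λ (k + 1) i) (hS : ∀ k, ∑ i ∈ range (k + 1), Λ (k + 1) i ≤ S)
    {gs : ℕ → ℝ} (hgs : gs ∈ Window γ) (hdec : ∀ k, Decay510 (kernelA F ℰ ρ bV gs k μ ν) C κ) :
    ∀ g ∈ Window γ, ∀ k : ℕ, Decay510 (kernelA F ℰ ρ bV g k μ ν) (C + γ * S) κ := by
  intro g hg k z
  have hne := (ne9_EA_iff F ℰ ρ bV (Window γ) κ Λ).1 h9 g hg gs hgs k μ ν z
  have hdz := hdec k z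
  have hcoord : ∀ i, |g i - gs i| ≤ γ := by
    intro i
    have h1 := hg i
    have h2 := hgs i
    rw [abs_sub_le_iff]
    constructor <;> linarith
  have hsum : ∑ i ∈ range (k + 1), Λ (k + 1) i * |g i - gs i| ≤ γ * S := by
    calc ∑ i ∈ range (k + 1), Λ (k + 1) i * |g i - gs i| ≤ ∑ i ∈ range (k + 1), Λ (k + 1) i * γ :=
          Finset.sum_le_sum fun i hi => mul_le_mul_of_nonneg_left (hcoord i) (hΛ k i hi)
      _ = γ * ∑ i ∈ range (k + 1), Λ (k + 1) i := by rw [Finset.mul_sum]; exact Finset.sum_congr rfl fun i _ => mul_comm _ _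
      _ ≤ γ * S := mul_le_mul_of_nonneg_left (hS k) hγ
  have hexp : 0 ≤ Real.exp (-(κ * l1 z)) := Real.exp_nonneg _
  have htri : |kernelA F ℰ ρ bV g k μ ν z| ≤ |kernelA F ℰ ρ bV gs k μ ν z| + |kernelA F ℰ ρ bV g k μ ν z - kernelA F ℰ ρ bV gs k μ ν z| := by
    have := abs_add_le (kernelA F ℰ ρ bV gs k μ ν z) (kernelA F ℰ ρ bV g k μ ν z - kernelA F ℰ ρ bV gs k μ ν z)
    rwa [add_sub_cancel] at this
  have hrhs : Real.exp (-(κ * l1 z)) * ∑ i ∈ range (k + 1), Λ (k + 1) i * |g i - gs i| ≤ Real.exp (-κ * l1 z) * (γ * S) := by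
    rw [neg_mul]
    exact mul_le_mul_of_nonneg_left hsum hexp
  calc |kernelA F ℰ ρ bV g k μ ν z| ≤ C * Real.exp (-κ * l1 z) + Real.exp (-κ * l1 z) * (γ * S) := by linarith
    _ = (C + γ * S) * Real.exp (-κ * l1 z) := by ring

end Helpers

/-! ## §2  θ-generic suppliers at the record (new public statements; the residue's `…RunwiseSuppliers` §3 ∕ `…BoxOfKernelLetters` §2 up to form) -/

section Record

variable (F : T4Family) (N : ℕ) [NeZero N] (θ : Stage13Params F N)

/-- On a box history `v ∈ ]0, γ₀]^{k+1}` (`γ₀ ≤ θ.γ`) the β of record IS (1.22) of W1-19's limiting kernel of the padded sequence `extd v` (unfolding `betaOfMerged_of_mem` +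
`secondMoment_kernelA_extd`; the residue's `betaOfRecord₁₃_eq_secondMoment_kernelA_extd`, re-homed `private`). [cite: Balaban1987RG1, (1.20)–(1.22) p.264 (bookkeeping)] -/
private theorem beta_eq_secondMoment_extd {γ₀ : ℝ} (hγ : γ₀ ≤ θ.γ) {k : ℕ} {v : Fin (k + 1) → ℝ} (hv : v ∈ Box γ₀ k) :
    betaOfRecord₁₃ F N θ k v =
      (letI := θ.instVβ₁; letI := θ.instVβ₂; letI := θ.instιβ
       B12Beta.secondMoment (kernelA F (mergedTermFamilyMatT F N (TβOfRecord₁₃ F N) (chiβOfRecord₁₃ F N θ) θ.εbg) θ.ρ8 θ.bV (extd v) k) 0 1) := by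
  letI := θ.instVβ₁; letI := θ.instVβ₂; letI := θ.instιβ
  have hbox : v ∈ Box θ.γ k := box_mono hγ k hv
  rw [betaOfRecord₁₃_eq_betaOfRecord₈Tχ, U3OfKernels.secondMoment_kernelA_extd]
  exact betaOfMerged_of_mem _ _ _ hbox

/-- **★ ONE-CONSTANT (5.10) DECAY OF THE LIMITING KERNELS OVER THE WINDOW `]0, γ₀]^ℕ` ⟹ `|β₁₃(θ)_{k+1}(v)| ≤ β′₅₁₀(C, δ₁)` ON EVERY BOX `]0, γ₀]^{k+1}`** (`γ₀ ≤ θ.γ`, `0 < δ₁`;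
`β′₅₁₀ = C·Σ_{x∈ℤ⁴}|x|₁² e^{−δ₁|x|₁}` — b12 `secondMoment_abs_le_of_decay510`: (5.42) + (5.10) ⇒ [I] p. 264 «uniformly bounded»).  θ-GENERIC; CONDITIONAL on the displayed decay (W1-19's
`KernelDecayOfRecord₁₃` shape with the constant UNIFORM over the window). [cite: Balaban1987RG1, (5.10) p.293, (5.42) p.297, (1.22) p.264, §1 p.264] -/
theorem abs_betaOfRecord₁₃_le_of_kernelDecayWindowUniform {γ₀ C δ₁ : ℝ} (hδ : 0 < δ₁) (hγ : γ₀ ≤ θ.γ)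
    (hdec : letI := θ.instVβ₁; letI := θ.instVβ₂; letI := θ.instιβ
      ∀ g ∈ Window γ₀, ∀ k : ℕ, Decay510 (kernelA F (mergedTermFamilyMatT F N (TβOfRecord₁₃ F N) (chiβOfRecord₁₃ F N θ) θ.εbg) θ.ρ8 θ.bV g k 0 1) C δ₁)
    (k : ℕ) (v : Fin (k + 1) → ℝ) (hv : v ∈ Box γ₀ k) : |betaOfRecord₁₃ F N θ k v| ≤ betaPrime510 4 C δ₁ := by
  letI := θ.instVβ₁; letI := θ.instVβ₂; letI := θ.instιβ
  rw [beta_eq_secondMoment_extd F N θ hγ hv]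
  exact (secondMoment_abs_le_of_decay510 hδ (hdec (extd v) (extd_mem_window hv) k)).2

/-- **★ THE SIGN-FREE β-BOX ON `]0, γ₀]` FROM ONE-CONSTANT (5.10) DECAY OVER THE WINDOW** (∃-form with `0 ≤ β′`; the constant is `β′₅₁₀(C, δ₁)`).  θ-GENERIC; CONDITIONAL. [cite: Balaban1987RG1, (5.10) p.293, (5.42) p.297, (1.22) p.264, §1 p.264 («uniformly bounded»)] -/
theorem exists_absBetaBox_of_kernelDecayWindowUniform {γ₀ C δ₁ : ℝ} (hδ : 0 < δ₁) (hγ0 : 0 < γ₀) (hγ : γ₀ ≤ θ.γ)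
    (hdec : letI := θ.instVβ₁; letI := θ.instVβ₂; letI := θ.instιβ
      ∀ g ∈ Window γ₀, ∀ k : ℕ, Decay510 (kernelA F (mergedTermFamilyMatT F N (TβOfRecord₁₃ F N) (chiβOfRecord₁₃ F N θ) θ.εbg) θ.ρ8 θ.bV g k 0 1) C δ₁) :
    ∃ β' : ℝ, 0 ≤ β' ∧ BetaLowerH (-β') γ₀ (betaOfRecord₁₃ F N θ) ∧ BetaUpperH β' γ₀ (betaOfRecord₁₃ F N θ) := by
  have key := abs_betaOfRecord₁₃_le_of_kernelDecayWindowUniform F N θ hδ hγ hdec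
  have hv0 : (fun _ : Fin (0 + 1) => γ₀) ∈ Box γ₀ 0 := mem_box.mpr fun _ => ⟨hγ0, le_rfl⟩
  exact ⟨betaPrime510 4 C δ₁, (abs_nonneg _).trans (key 0 _ hv0), fun k v hv => (abs_le.mp (key k v hv)).1, fun k v hv => (abs_le.mp (key k v hv)).2⟩

/-- **★★ W1-19c's UNIFORM WINDOWED (5.10) LETTER + THE (1.21) EXISTENCE LETTER ⟹ `|β₁₃(θ)| ≤ β′₅₁₀(E₀, κ)` ON EVERY BOX OF THE FULL WINDOW** (`0 < κ`): the windowed finite-volume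
bounds `|Π^{(K)}_{k+1,01}(g; z)| ≤ E₀ e^{−κ|z|₁}` eventually in `K`, ONE constant over `g ∈ ]0, θ.γ]^ℕ` and all `k` (`WindowedDecayUniformOfRecord₁₃ F N θ E₀ κ` — the letter node N18's
mechanism `…N18UniformDecayOfStepRate.windowedDecayUniformOfRecord₁₃_of_windowedStepRateOfRecord₁₃_of_base` PRODUCES from the step-rate letter + the level-0 row), and
`PolLimitsExistOfRecord₁₃ F N θ` ([I] (1.21) «This limit exists») give, by n22-w3's `decay510_kernelA_of_windowed` (`le_of_tendsto`), one-constant decay of the LIMITING kernels, hence the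
bound (previous theorems).  θ-GENERIC; CONDITIONAL on the two letters; NO NE9, NO fading memory, NO run letter. [cite: Balaban1987RG1, (1.21)–(1.22) p.264, §1 p.264, (5.10) p.293, (5.42) p.297] -/
theorem abs_betaOfRecord₁₃_le_of_windowedDecayUniform_of_polLimitsExist {E₀ κ : ℝ} (hκ : 0 < κ)
    (hlim : PolLimitsExistOfRecord₁₃ F N θ) (hU : WindowedDecayUniformOfRecord₁₃ F N θ E₀ κ)
    (k : ℕ) (v : Fin (k + 1) → ℝ) (hv : v ∈ Box θ.γ k) : |betaOfRecord₁₃ F N θ k v| ≤ betaPrime510 4 E₀ κ := by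
  letI := θ.instVβ₁; letI := θ.instVβ₂; letI := θ.instιβ
  refine abs_betaOfRecord₁₃_le_of_kernelDecayWindowUniform F N θ hκ le_rfl (fun g hg k => ?_) k v hv
  exact decay510_kernelA_of_windowed F _ θ.ρ8 θ.bV ((polLimitsExistOfRecord₁₃_iff F N θ).1 hlim g hg k) (fun z => hU g hg k 0 1 z)

/-- **★★ THE SIGN-FREE β-BOX ON THE FULL WINDOW FROM W1-19c's UNIFORM LETTER + (1.21) EXISTENCE** (∃-form, `0 ≤ β′`; `0 < θ.γ`).  θ-GENERIC; CONDITIONAL on the two letters.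
[cite: Balaban1987RG1, (1.21)–(1.22) p.264, §1 p.264 («uniformly bounded»), (5.10) p.293] -/
theorem exists_absBetaBox_of_windowedDecayUniform_of_polLimitsExist {E₀ κ : ℝ} (hκ : 0 < κ) (hγ : 0 < θ.γ)
    (hlim : PolLimitsExistOfRecord₁₃ F N θ) (hU : WindowedDecayUniformOfRecord₁₃ F N θ E₀ κ) :
    ∃ β' : ℝ, 0 ≤ β' ∧ BetaLowerH (-β') θ.γ (betaOfRecord₁₃ F N θ) ∧ BetaUpperH β' θ.γ (betaOfRecord₁₃ F N θ) := by
  have key := abs_betaOfRecord₁₃_le_of_windowedDecayUniform_of_polLimitsExist F N θ hκ hlim hU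
  have hv0 : (fun _ : Fin (0 + 1) => θ.γ) ∈ Box θ.γ 0 := mem_box.mpr fun _ => ⟨hγ, le_rfl⟩
  exact ⟨betaPrime510 4 E₀ κ, (abs_nonneg _).trans (key 0 _ hv0), fun k v hv => (abs_le.mp (key k v hv)).1, fun k v hv => (abs_le.mp (key k v hv)).2⟩

/-- **★★ NODE N18's STEP-RATE LETTER + THE LEVEL-0 ROW + (1.21) EXISTENCE ⟹ THE SIGN-FREE β-BOX ON THE FULL WINDOW** (`0 < κ`, `0 ≤ θ₅ < 1`, `0 ≤ C′`, `0 < θ.γ`):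
`WindowedStepRateOfRecord₁₃ F N θ s κ θ₅ C′` ([I] Thm 1's two-run comparison in kernel currency, node N18's input), the level-0 windowed decay `|Π^{(K)}_{1,μν}(g₀; z)| ≤ E₀e^{−κ|z|₁}`
eventually in `K`, and `PolLimitsExistOfRecord₁₃ F N θ` give `∃ β′ ≥ 0`, `−β′ ≤ β₁₃(θ) ≤ β′` on every `]0, θ.γ]^{k+1}` — dag-n18-w4's telescope produces the uniform letter with the constant
`E₀ + C′∕(1−θ₅)`, then the previous theorem.  θ-GENERIC; CONDITIONAL on the three letters (node N18's ∕ (D4)'s ∕ W1's walls); nothing of Bałaban asserted. [cite: Balaban1987RG1, Thm 1 p.259, (1.21)–(1.22) p.264, §1 p.264, (5.10) p.293] -/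
theorem exists_absBetaBox_of_windowedStepRate_of_base_of_polLimitsExist {κ θ₅ C' E₀ : ℝ} {s : ℕ} (hκ : 0 < κ) (hγ : 0 < θ.γ)
    (hθ0 : 0 ≤ θ₅) (hθ1 : θ₅ < 1) (hC' : 0 ≤ C') (hlim : PolLimitsExistOfRecord₁₃ F N θ) (hS : WindowedStepRateOfRecord₁₃ F N θ s κ θ₅ C')
    (h0 : letI := θ.instVβ₁; letI := θ.instVβ₂; letI := θ.instιβ
      ∀ g ∈ Window θ.γ, ∀ (μ ν : Fin 4) (z : Fin 4 → ℤ), ∀ᶠ K in atTop,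
        |polWindow F K 1 (mergedTermFamilyMatT F N (TβOfRecord₁₃ F N) (chiβOfRecord₁₃ F N θ) θ.εbg 0 (histPrefix g 0) K) θ.ρ8 θ.bV μ ν z| ≤
          E₀ * Real.exp (-κ * l1 z)) :
    ∃ β' : ℝ, 0 ≤ β' ∧ BetaLowerH (-β') θ.γ (betaOfRecord₁₃ F N θ) ∧ BetaUpperH β' θ.γ (betaOfRecord₁₃ F N θ) :=
  exists_absBetaBox_of_windowedDecayUniform_of_polLimitsExist F N θ hκ hγ hlim
    (windowedDecayUniformOfRecord₁₃_of_windowedStepRateOfRecord₁₃_of_base F N θ hθ0 hθ1 hC' hS h0)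

/-- **★★ THE SIGN-FREE β-BOX OF THE RECORD ON ITS FULL WINDOW FROM THE K3-SIDE KERNEL LETTERS ALONE** (`0 < θ.γ`, `0 < κ`): N22's kernel-currency NE9 of the functional of record
`(objectsOfRecord₁₃ F N θ ℓ).EA 0` on `Window θ.γ` with node-U3 fading-memory moduli (`FadingMemory C₉ ω Λ`, `0 ≤ ω < 1`) and the (D4) clause `KernelDecayOfRecord₁₃ F N θ 0 1 κ` (PER-SEQUENCE
constants, read at the one constant sequence `θ.γ`) ⟹ `∃ β′ ≥ 0`, `−β′ ≤ β₁₃(θ) ≤ β′` on every `]0, θ.γ]^{k+1}` (§1 makes the decay constant uniform; then the previous theorem).  θ-GENERIC;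
CONDITIONAL on the three letters; NO separate β-estimate. [cite: Balaban1987RG1, (1.20)–(1.22) p.264, §1 p.264, (1.18) p.263, (5.10) p.293, (5.42) p.297; Balaban1988RG2Cluster, (2.13)–(2.14) pp.14–15] -/
theorem exists_absBetaBox_of_kernelNE9_of_kernelDecay (ℓ : U3Letters₁₁) {κ C₉ ω : ℝ} {Λ : ℕ → ℕ → ℝ} (hκ : 0 < κ) (hγ : 0 < θ.γ)
    (h9 : NE9 ((objectsOfRecord₁₃ F N θ ℓ).EA 0) (Window θ.γ) κ Λ) (hΛ : FadingMemory C₉ ω Λ) (hω0 : 0 ≤ ω) (hω1 : ω < 1)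
    (hdec : KernelDecayOfRecord₁₃ F N θ 0 1 κ) :
    ∃ β' : ℝ, 0 ≤ β' ∧ BetaLowerH (-β') θ.γ (betaOfRecord₁₃ F N θ) ∧ BetaUpperH β' θ.γ (betaOfRecord₁₃ F N θ) := by
  letI := θ.instVβ₁; letI := θ.instVβ₂; letI := θ.instιβ
  have hconst : (fun _ : ℕ => θ.γ) ∈ Window θ.γ := fun _ => ⟨hγ, le_rfl⟩
  obtain ⟨C, hC⟩ := hdec (fun _ => θ.γ) hconst
  have hunif := decayUniform_of_ne9_of_decayAt F _ θ.ρ8 θ.bV (μ := 0) (ν := 1) hγ.le h9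
    (fun k i hi => (hΛ (k + 1) i (by have := Finset.mem_range.mp hi; omega)).1) (rowSum_le_of_fadingMemory hΛ hω0 hω1) hconst hC
  exact exists_absBetaBox_of_kernelDecayWindowUniform F N θ hκ hγ le_rfl hunif

/-- **★★ THE SAME FROM W1's THREE WINDOWED LETTERS OF RECORD** — `PolLimitsExistOfRecord₁₃ F N θ` ([I] (1.21) «This limit exists»), `WindowedNE9OfRecord₁₃ F N θ κ Λ` (N22's windowed
joint history-Lipschitz bounds) with fading-memory moduli, `WindowedDecayOfRecord₁₃ F N θ 0 1 κ` ((D4)'s windowed (5.10) bounds) — through n22-w3's `ne9_EA_of_windowed` and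
`kernelDecayOfRecord₁₃_of_windowed` (limits of eventually-bounded sequences).  θ-GENERIC; CONDITIONAL on the three letters. [cite: Balaban1987RG1, (1.21)–(1.22) p.264, §1 p.264, (1.18) p.263, (5.10) p.293] -/
theorem exists_absBetaBox_of_W1Letters {κ C₉ ω : ℝ} {Λ : ℕ → ℕ → ℝ} (hκ : 0 < κ) (hγ : 0 < θ.γ)
    (hlim : PolLimitsExistOfRecord₁₃ F N θ) (h9w : WindowedNE9OfRecord₁₃ F N θ κ Λ) (hΛ : FadingMemory C₉ ω Λ) (hω0 : 0 ≤ ω) (hω1 : ω < 1)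
    (hdecw : WindowedDecayOfRecord₁₃ F N θ 0 1 κ) :
    ∃ β' : ℝ, 0 ≤ β' ∧ BetaLowerH (-β') θ.γ (betaOfRecord₁₃ F N θ) ∧ BetaUpperH β' θ.γ (betaOfRecord₁₃ F N θ) := by
  letI := θ.instVβ₁; letI := θ.instVβ₂; letI := θ.instιβ
  -- `objectsOfRecord₁₃`'s run-A functional `.EA 0` does not read the letter block; any block phrases NE9
  let ℓ : U3Letters₁₁ := ⟨κ, 0, 0, C₉, ω, 0, 0⟩
  have h9 : NE9 ((objectsOfRecord₁₃ F N θ ℓ).EA 0) (Window θ.γ) κ Λ := ne9_EA_of_windowed F _ θ.ρ8 θ.bV hlim h9w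
  have hdec : KernelDecayOfRecord₁₃ F N θ 0 1 κ := kernelDecayOfRecord₁₃_of_windowed F N θ 0 1 κ hlim hdecw
  exact exists_absBetaBox_of_kernelNE9_of_kernelDecay F N θ ℓ hκ hγ h9 hΛ hω0 hω1 hdec

end Record

/-! ## §3  At the print-regime Z3 members `θ₁₃ᶜᶜᴹᵂᶻᴮ(j; γ₀; εbg := a₀; ε₀, ε₂₉; B₃, B₃′, a₀, a₁; Efl, logz)`: each supplier ⟹ THE TOKEN-FREE CORE of the V23 stub-3ᴬ′ᴮ text -/

section ZB

variable (F : T4Family)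

/-- Letter census at the half-window print-regime Z3 member (`rfl`; = ✓p769914 `K0V23Stub3Sockets.betaOfRecord₁₃_zbRegime_letterBlind`, `private` here to stay route-independent). [cite: Balaban1987RG1, (1.20)–(1.22) p.264, (2.9) p.266 (bookkeeping)] -/
private theorem census (j j' : ℕ) (a₀ ε₀ ε₀' ε₂₉ B₃ C₃ B₃' C₃' a₁ c₁ : ℝ) (Efl logz Efl' logz' : B12.RunParams → ℕ → ℝ) :
    betaOfRecord₁₃ F 2 (theta13OfThm1CCMWZB F 2 j (1 / 2) a₀ ε₀ ε₂₉ B₃ B₃' a₀ a₁ Efl logz) =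
      betaOfRecord₁₃ F 2 (theta13OfThm1CCMWZB F 2 j' (1 / 2) a₀ ε₀' ε₂₉ C₃ C₃' a₀ c₁ Efl' logz') := rfl

/-- **★ WINDOW EDITION ⟹ THE TOKEN-FREE CORE**: per radius `a₀ > 0`, ONE sign-free box on `]0, γ₀]` (`0 < γ₀ ≤ ½`) of the `γ₀`-WINDOW print-regime member
`θ₁₃ᶜᶜᴹᵂᶻᴮ(j; γ₀; a₀; ε₀, ε₂₉; B₃, B₃′, a₀, a₁; Efl, logz)` at ANY letters — the shape a NODE O ∕ K3-side supplier working at a SMALL coupling window meets — IS the token-free core of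
✓p769914 (DEF-1's transfer `betaLowerH∕UpperH_half_of_theta13OfThm1CCMWZB`: on `]0, γ₀] ⊆ ]0, ½]` both box conventions read the same `β_merged`; then the letter census).
CONDITIONAL; nothing asserted. [cite: Balaban1987RG1, Thm 1 p.259, (1.20)–(1.22) p.264, (1.6) p.261, (2.12)–(2.14) p.268, §1 p.264; Balaban1989LargeFieldII, (1.4) p.357, p.355] -/
theorem tokenFreeZB_of_windowBoxAtZB
    (h : ∀ a₀ : ℝ, 0 < a₀ → ∃ (γ₀ ε₂₉ β' : ℝ) (j : ℕ) (ε₀ B₃ B₃' a₁ : ℝ) (Efl logz : B12.RunParams → ℕ → ℝ), 0 < γ₀ ∧ γ₀ ≤ 1 / 2 ∧ 0 < ε₂₉ ∧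
      BetaLowerH (-β') γ₀ (betaOfRecord₁₃ F 2 (theta13OfThm1CCMWZB F 2 j γ₀ a₀ ε₀ ε₂₉ B₃ B₃' a₀ a₁ Efl logz)) ∧
      BetaUpperH β' γ₀ (betaOfRecord₁₃ F 2 (theta13OfThm1CCMWZB F 2 j γ₀ a₀ ε₀ ε₂₉ B₃ B₃' a₀ a₁ Efl logz))) :
    ∀ a₀ : ℝ, 0 < a₀ → ∃ γ₀ ε₂₉ β' : ℝ, 0 < γ₀ ∧ 0 < ε₂₉ ∧ ∀ (j : ℕ) (ε₀ B₃ B₃' a₁ : ℝ),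
      BetaLowerH (-β') γ₀ (betaOfRecord₁₃ F 2 (theta13OfThm1CCMWZB F 2 j (1 / 2) a₀ ε₀ ε₂₉ B₃ B₃' a₀ a₁ (fun _ _ => 0) (fun _ _ => 0))) ∧
      BetaUpperH β' γ₀ (betaOfRecord₁₃ F 2 (theta13OfThm1CCMWZB F 2 j (1 / 2) a₀ ε₀ ε₂₉ B₃ B₃' a₀ a₁ (fun _ _ => 0) (fun _ _ => 0))) := by
  intro a₀ ha₀
  obtain ⟨γ₀, ε₂₉, β', j, ε₀, B₃, B₃', a₁, Efl, logz, hγ₀, hγhalf, hε', hlow, hup⟩ := h a₀ ha₀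
  have hlow' := betaLowerH_half_of_theta13OfThm1CCMWZB hγhalf hlow
  have hup' := betaUpperH_half_of_theta13OfThm1CCMWZB hγhalf hup
  refine ⟨γ₀, ε₂₉, β', hγ₀, hε', fun j' ε₀' C₃ C₃' c₁' => ?_⟩
  rw [← census F j j' a₀ ε₀ ε₀' ε₂₉ B₃ C₃ B₃' C₃' a₁ c₁' Efl logz (fun _ _ => 0) (fun _ _ => 0)]
  exact ⟨hlow', hup'⟩

/-- **★★ ONE-CONSTANT (5.10) DECAY AT A WINDOW MEMBER, PER RADIUS ⟹ THE TOKEN-FREE CORE**: for every `a₀ > 0` SOME `γ₀ ∈ ]0, ½]`, `ε₂₉ > 0`, letters `(j, ε₀, B₃, B₃′, a₁, Efl, logz)`,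
a rate `δ₁ > 0` and ONE constant `C` with `|Π_{k+1}(g; z)| ≤ C e^{−δ₁|z|₁}` for W1-19's limiting kernels of `θ := θ₁₃ᶜᶜᴹᵂᶻᴮ(j; γ₀; a₀; ε₀, ε₂₉; …)` along EVERY `g ∈ ]0, γ₀]^ℕ` and level `k`
⟹ the token-free core (§2 at `θ` — its window IS `γ₀` — then the window edition).  CONDITIONAL on the displayed decay ([I] (5.10) at the record, k-uniform constant: NODE O's ∕ (D4)'s
wall); nothing asserted. [cite: Balaban1987RG1, (5.10) p.293, (5.42) p.297, (1.20)–(1.22) p.264, §1 p.264; Balaban1989LargeFieldII, p.355] -/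
theorem tokenFreeZB_of_kernelDecayWindowUniformAtZB
    (h : ∀ a₀ : ℝ, 0 < a₀ → ∃ (γ₀ ε₂₉ : ℝ) (j : ℕ) (ε₀ B₃ B₃' a₁ : ℝ) (Efl logz : B12.RunParams → ℕ → ℝ) (C δ₁ : ℝ), 0 < γ₀ ∧ γ₀ ≤ 1 / 2 ∧ 0 < ε₂₉ ∧ 0 < δ₁ ∧
      letI θ := theta13OfThm1CCMWZB F 2 j γ₀ a₀ ε₀ ε₂₉ B₃ B₃' a₀ a₁ Efl logz
      letI := θ.instVβ₁; letI := θ.instVβ₂; letI := θ.instιβ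
      ∀ g ∈ Window γ₀, ∀ k : ℕ, Decay510 (kernelA F (mergedTermFamilyMatT F 2 (TβOfRecord₁₃ F 2) (chiβOfRecord₁₃ F 2 θ) θ.εbg) θ.ρ8 θ.bV g k 0 1) C δ₁) :
    ∀ a₀ : ℝ, 0 < a₀ → ∃ γ₀ ε₂₉ β' : ℝ, 0 < γ₀ ∧ 0 < ε₂₉ ∧ ∀ (j : ℕ) (ε₀ B₃ B₃' a₁ : ℝ),
      BetaLowerH (-β') γ₀ (betaOfRecord₁₃ F 2 (theta13OfThm1CCMWZB F 2 j (1 / 2) a₀ ε₀ ε₂₉ B₃ B₃' a₀ a₁ (fun _ _ => 0) (fun _ _ => 0))) ∧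
      BetaUpperH β' γ₀ (betaOfRecord₁₃ F 2 (theta13OfThm1CCMWZB F 2 j (1 / 2) a₀ ε₀ ε₂₉ B₃ B₃' a₀ a₁ (fun _ _ => 0) (fun _ _ => 0))) := by
  refine tokenFreeZB_of_windowBoxAtZB F fun a₀ ha₀ => ?_
  obtain ⟨γ₀, ε₂₉, j, ε₀, B₃, B₃', a₁, Efl, logz, C, δ₁, hγ₀, hγhalf, hε', hδ, hdec⟩ := h a₀ ha₀
  have hγθ : γ₀ ≤ (theta13OfThm1CCMWZB F 2 j γ₀ a₀ ε₀ ε₂₉ B₃ B₃' a₀ a₁ Efl logz).γ := by rw [theta13OfThm1CCMWZB_γ]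
  obtain ⟨β', -, hlow, hup⟩ := exists_absBetaBox_of_kernelDecayWindowUniform F 2 _ hδ hγ₀ hγθ hdec
  exact ⟨γ₀, ε₂₉, β', j, ε₀, B₃, B₃', a₁, Efl, logz, hγ₀, hγhalf, hε', hlow, hup⟩

/-- **★★ W1-19c's UNIFORM LETTER + (1.21) EXISTENCE AT A WINDOW MEMBER, PER RADIUS ⟹ THE TOKEN-FREE CORE**: for every `a₀ > 0` SOME `γ₀ ∈ ]0, ½]`, `ε₂₉ > 0`, letters, a rate
`κ > 0` and ONE constant `E₀` with `PolLimitsExistOfRecord₁₃` and `WindowedDecayUniformOfRecord₁₃ … E₀ κ` at `θ₁₃ᶜᶜᴹᵂᶻᴮ(j; γ₀; a₀; ε₀, ε₂₉; …)` (window `γ₀`) ⟹ the token-free core —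
the TWO-LETTER road (node N18's mechanism produces the uniform letter from its step rate + the level-0 row; (1.21) is W1's existence letter).  CONDITIONAL on the two letters.
[cite: Balaban1987RG1, (1.21)–(1.22) p.264, §1 p.264, (5.10) p.293; Balaban1989LargeFieldII, p.355] -/
theorem tokenFreeZB_of_windowedDecayUniform_of_polLimitsExistAtZB
    (h : ∀ a₀ : ℝ, 0 < a₀ → ∃ (γ₀ ε₂₉ : ℝ) (j : ℕ) (ε₀ B₃ B₃' a₁ : ℝ) (Efl logz : B12.RunParams → ℕ → ℝ) (E₀ κ : ℝ), 0 < γ₀ ∧ γ₀ ≤ 1 / 2 ∧ 0 < ε₂₉ ∧ 0 < κ ∧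
      PolLimitsExistOfRecord₁₃ F 2 (theta13OfThm1CCMWZB F 2 j γ₀ a₀ ε₀ ε₂₉ B₃ B₃' a₀ a₁ Efl logz) ∧
      WindowedDecayUniformOfRecord₁₃ F 2 (theta13OfThm1CCMWZB F 2 j γ₀ a₀ ε₀ ε₂₉ B₃ B₃' a₀ a₁ Efl logz) E₀ κ) :
    ∀ a₀ : ℝ, 0 < a₀ → ∃ γ₀ ε₂₉ β' : ℝ, 0 < γ₀ ∧ 0 < ε₂₉ ∧ ∀ (j : ℕ) (ε₀ B₃ B₃' a₁ : ℝ),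
      BetaLowerH (-β') γ₀ (betaOfRecord₁₃ F 2 (theta13OfThm1CCMWZB F 2 j (1 / 2) a₀ ε₀ ε₂₉ B₃ B₃' a₀ a₁ (fun _ _ => 0) (fun _ _ => 0))) ∧
      BetaUpperH β' γ₀ (betaOfRecord₁₃ F 2 (theta13OfThm1CCMWZB F 2 j (1 / 2) a₀ ε₀ ε₂₉ B₃ B₃' a₀ a₁ (fun _ _ => 0) (fun _ _ => 0))) := by
  refine tokenFreeZB_of_windowBoxAtZB F fun a₀ ha₀ => ?_
  obtain ⟨γ₀, ε₂₉, j, ε₀, B₃, B₃', a₁, Efl, logz, E₀, κ, hγ₀, hγhalf, hε', hκ, hlim, hU⟩ := h a₀ ha₀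
  have hγθ : (theta13OfThm1CCMWZB F 2 j γ₀ a₀ ε₀ ε₂₉ B₃ B₃' a₀ a₁ Efl logz).γ = γ₀ := theta13OfThm1CCMWZB_γ F 2 j γ₀ a₀ ε₀ ε₂₉ B₃ B₃' a₀ a₁ Efl logz
  have hγpos : 0 < (theta13OfThm1CCMWZB F 2 j γ₀ a₀ ε₀ ε₂₉ B₃ B₃' a₀ a₁ Efl logz).γ := by rw [hγθ]; exact hγ₀
  obtain ⟨β', -, hlow, hup⟩ := exists_absBetaBox_of_windowedDecayUniform_of_polLimitsExist F 2 _ hκ hγpos hlim hU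
  rw [hγθ] at hlow hup
  exact ⟨γ₀, ε₂₉, β', j, ε₀, B₃, B₃', a₁, Efl, logz, hγ₀, hγhalf, hε', hlow, hup⟩

/-- **★★ NODE N18's STEP-RATE LETTER + LEVEL-0 ROW + (1.21) EXISTENCE AT A WINDOW MEMBER, PER RADIUS ⟹ THE TOKEN-FREE CORE**: for every `a₀ > 0` SOME `γ₀ ∈ ]0, ½]`,
`ε₂₉ > 0`, letters, `κ > 0`, `0 ≤ θ₅ < 1`, `0 ≤ C′`, `E₀`, a volume shift `s` with `PolLimitsExistOfRecord₁₃`, `WindowedStepRateOfRecord₁₃ … s κ θ₅ C′` and the level-0 windowed decay at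
`θ₁₃ᶜᶜᴹᵂᶻᴮ(j; γ₀; a₀; ε₀, ε₂₉; …)` ⟹ the token-free core.  CONDITIONAL on node N18's ∕ (D4)'s level-0 ∕ W1's letters (inhabited nowhere here). [cite: Balaban1987RG1, Thm 1 p.259, (1.21)–(1.22) p.264, §1 p.264, (5.10) p.293; Balaban1989LargeFieldII, p.355] -/
theorem tokenFreeZB_of_N18StepRateAtZB
    (h : ∀ a₀ : ℝ, 0 < a₀ → ∃ (γ₀ ε₂₉ : ℝ) (j : ℕ) (ε₀ B₃ B₃' a₁ : ℝ) (Efl logz : B12.RunParams → ℕ → ℝ) (κ θ₅ C' E₀ : ℝ) (s : ℕ),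
      0 < γ₀ ∧ γ₀ ≤ 1 / 2 ∧ 0 < ε₂₉ ∧ 0 < κ ∧ 0 ≤ θ₅ ∧ θ₅ < 1 ∧ 0 ≤ C' ∧
      PolLimitsExistOfRecord₁₃ F 2 (theta13OfThm1CCMWZB F 2 j γ₀ a₀ ε₀ ε₂₉ B₃ B₃' a₀ a₁ Efl logz) ∧
      WindowedStepRateOfRecord₁₃ F 2 (theta13OfThm1CCMWZB F 2 j γ₀ a₀ ε₀ ε₂₉ B₃ B₃' a₀ a₁ Efl logz) s κ θ₅ C' ∧
      (letI θ := theta13OfThm1CCMWZB F 2 j γ₀ a₀ ε₀ ε₂₉ B₃ B₃' a₀ a₁ Efl logz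
       letI := θ.instVβ₁; letI := θ.instVβ₂; letI := θ.instιβ
       ∀ g ∈ Window γ₀, ∀ (μ ν : Fin 4) (z : Fin 4 → ℤ), ∀ᶠ K in atTop,
        |polWindow F K 1 (mergedTermFamilyMatT F 2 (TβOfRecord₁₃ F 2) (chiβOfRecord₁₃ F 2 θ) θ.εbg 0 (histPrefix g 0) K) θ.ρ8 θ.bV μ ν z| ≤
          E₀ * Real.exp (-κ * l1 z))) :
    ∀ a₀ : ℝ, 0 < a₀ → ∃ γ₀ ε₂₉ β' : ℝ, 0 < γ₀ ∧ 0 < ε₂₉ ∧ ∀ (j : ℕ) (ε₀ B₃ B₃' a₁ : ℝ),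
      BetaLowerH (-β') γ₀ (betaOfRecord₁₃ F 2 (theta13OfThm1CCMWZB F 2 j (1 / 2) a₀ ε₀ ε₂₉ B₃ B₃' a₀ a₁ (fun _ _ => 0) (fun _ _ => 0))) ∧
      BetaUpperH β' γ₀ (betaOfRecord₁₃ F 2 (theta13OfThm1CCMWZB F 2 j (1 / 2) a₀ ε₀ ε₂₉ B₃ B₃' a₀ a₁ (fun _ _ => 0) (fun _ _ => 0))) := by
  refine tokenFreeZB_of_windowBoxAtZB F fun a₀ ha₀ => ?_
  obtain ⟨γ₀, ε₂₉, j, ε₀, B₃, B₃', a₁, Efl, logz, κ, θ₅, C', E₀, s, hγ₀, hγhalf, hε', hκ, hθ0, hθ1, hC', hlim, hS, h0⟩ := h a₀ ha₀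
  have hγθ : (theta13OfThm1CCMWZB F 2 j γ₀ a₀ ε₀ ε₂₉ B₃ B₃' a₀ a₁ Efl logz).γ = γ₀ := theta13OfThm1CCMWZB_γ F 2 j γ₀ a₀ ε₀ ε₂₉ B₃ B₃' a₀ a₁ Efl logz
  have hγpos : 0 < (theta13OfThm1CCMWZB F 2 j γ₀ a₀ ε₀ ε₂₉ B₃ B₃' a₀ a₁ Efl logz).γ := by rw [hγθ]; exact hγ₀
  rw [← hγθ] at h0
  obtain ⟨β', -, hlow, hup⟩ := exists_absBetaBox_of_windowedStepRate_of_base_of_polLimitsExist F 2 _ hκ hγpos hθ0 hθ1 hC' hlim hS h0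
  rw [hγθ] at hlow hup
  exact ⟨γ₀, ε₂₉, β', j, ε₀, B₃, B₃', a₁, Efl, logz, hγ₀, hγhalf, hε', hlow, hup⟩

/-- **★★ THE K3-SIDE KERNEL LETTERS AT A WINDOW MEMBER, PER RADIUS ⟹ THE TOKEN-FREE CORE**: for every `a₀ > 0` SOME `γ₀ ∈ ]0, ½]`, `ε₂₉ > 0`, letters, a block `ℓ`, a rate `κ > 0` and
fading-memory moduli `(C₉, ω, Λ)`, `0 ≤ ω < 1`, with N22's kernel-currency NE9 on `Window γ₀` and the (D4) clause `KernelDecayOfRecord₁₃ … 0 1 κ` at `θ₁₃ᶜᶜᴹᵂᶻᴮ(j; γ₀; a₀; ε₀, ε₂₉; …)`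
⟹ the token-free core (§2 `exists_absBetaBox_of_kernelNE9_of_kernelDecay` at that member, then the window edition).  CONDITIONAL on the letters (NOT printed for d = 4; inhabited
nowhere here). [cite: Balaban1987RG1, (1.18) p.263, (1.20)–(1.22) p.264, §1 p.264, (5.10) p.293; Balaban1988RG2Cluster, (2.13)–(2.14) pp.14–15; Balaban1989LargeFieldII, p.355] -/
theorem tokenFreeZB_of_kernelNE9_of_kernelDecayAtZB
    (h : ∀ a₀ : ℝ, 0 < a₀ → ∃ (γ₀ ε₂₉ : ℝ) (j : ℕ) (ε₀ B₃ B₃' a₁ : ℝ) (Efl logz : B12.RunParams → ℕ → ℝ)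
      (ℓ : U3Letters₁₁) (κ C₉ ω : ℝ) (Λ : ℕ → ℕ → ℝ), 0 < γ₀ ∧ γ₀ ≤ 1 / 2 ∧ 0 < ε₂₉ ∧ 0 < κ ∧ 0 ≤ ω ∧ ω < 1 ∧
      NE9 ((objectsOfRecord₁₃ F 2 (theta13OfThm1CCMWZB F 2 j γ₀ a₀ ε₀ ε₂₉ B₃ B₃' a₀ a₁ Efl logz) ℓ).EA 0) (Window γ₀) κ Λ ∧
      FadingMemory C₉ ω Λ ∧
      KernelDecayOfRecord₁₃ F 2 (theta13OfThm1CCMWZB F 2 j γ₀ a₀ ε₀ ε₂₉ B₃ B₃' a₀ a₁ Efl logz) 0 1 κ) :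
    ∀ a₀ : ℝ, 0 < a₀ → ∃ γ₀ ε₂₉ β' : ℝ, 0 < γ₀ ∧ 0 < ε₂₉ ∧ ∀ (j : ℕ) (ε₀ B₃ B₃' a₁ : ℝ),
      BetaLowerH (-β') γ₀ (betaOfRecord₁₃ F 2 (theta13OfThm1CCMWZB F 2 j (1 / 2) a₀ ε₀ ε₂₉ B₃ B₃' a₀ a₁ (fun _ _ => 0) (fun _ _ => 0))) ∧
      BetaUpperH β' γ₀ (betaOfRecord₁₃ F 2 (theta13OfThm1CCMWZB F 2 j (1 / 2) a₀ ε₀ ε₂₉ B₃ B₃' a₀ a₁ (fun _ _ => 0) (fun _ _ => 0))) := by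
  refine tokenFreeZB_of_windowBoxAtZB F fun a₀ ha₀ => ?_
  obtain ⟨γ₀, ε₂₉, j, ε₀, B₃, B₃', a₁, Efl, logz, ℓ, κ, C₉, ω, Λ, hγ₀, hγhalf, hε', hκ, hω0, hω1, h9, hΛ, hdec⟩ := h a₀ ha₀
  have hγθ : (theta13OfThm1CCMWZB F 2 j γ₀ a₀ ε₀ ε₂₉ B₃ B₃' a₀ a₁ Efl logz).γ = γ₀ := theta13OfThm1CCMWZB_γ F 2 j γ₀ a₀ ε₀ ε₂₉ B₃ B₃' a₀ a₁ Efl logz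
  have hγpos : 0 < (theta13OfThm1CCMWZB F 2 j γ₀ a₀ ε₀ ε₂₉ B₃ B₃' a₀ a₁ Efl logz).γ := by rw [hγθ]; exact hγ₀
  rw [← hγθ] at h9
  obtain ⟨β', -, hlow, hup⟩ := exists_absBetaBox_of_kernelNE9_of_kernelDecay F 2 _ ℓ hκ hγpos h9 hΛ hω0 hω1 hdec
  rw [hγθ] at hlow hup
  exact ⟨γ₀, ε₂₉, β', j, ε₀, B₃, B₃', a₁, Efl, logz, hγ₀, hγhalf, hε', hlow, hup⟩

/-- **★★ W1's THREE WINDOWED LETTERS OF RECORD AT A WINDOW MEMBER, PER RADIUS ⟹ THE TOKEN-FREE CORE** (`PolLimitsExistOfRecord₁₃`, `WindowedNE9OfRecord₁₃ … κ Λ` with fading memory,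
`WindowedDecayOfRecord₁₃ … 0 1 κ` at `θ₁₃ᶜᶜᴹᵂᶻᴮ(j; γ₀; a₀; ε₀, ε₂₉; …)`, `0 < γ₀ ≤ ½`, `0 < ε₂₉`, `0 < κ`, `0 ≤ ω < 1`) — the end-to-end statement a NODE O ∕ N22 ∕ (D4) supplier at a
small coupling window meets on the V23 road.  CONDITIONAL on the letters. [cite: Balaban1987RG1, (1.21)–(1.22) p.264, §1 p.264, (1.18) p.263, (5.10) p.293; Balaban1989LargeFieldII, p.355] -/
theorem tokenFreeZB_of_W1LettersAtZB
    (h : ∀ a₀ : ℝ, 0 < a₀ → ∃ (γ₀ ε₂₉ : ℝ) (j : ℕ) (ε₀ B₃ B₃' a₁ : ℝ) (Efl logz : B12.RunParams → ℕ → ℝ)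
      (κ C₉ ω : ℝ) (Λ : ℕ → ℕ → ℝ), 0 < γ₀ ∧ γ₀ ≤ 1 / 2 ∧ 0 < ε₂₉ ∧ 0 < κ ∧ 0 ≤ ω ∧ ω < 1 ∧
      PolLimitsExistOfRecord₁₃ F 2 (theta13OfThm1CCMWZB F 2 j γ₀ a₀ ε₀ ε₂₉ B₃ B₃' a₀ a₁ Efl logz) ∧
      WindowedNE9OfRecord₁₃ F 2 (theta13OfThm1CCMWZB F 2 j γ₀ a₀ ε₀ ε₂₉ B₃ B₃' a₀ a₁ Efl logz) κ Λ ∧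
      FadingMemory C₉ ω Λ ∧
      WindowedDecayOfRecord₁₃ F 2 (theta13OfThm1CCMWZB F 2 j γ₀ a₀ ε₀ ε₂₉ B₃ B₃' a₀ a₁ Efl logz) 0 1 κ) :
    ∀ a₀ : ℝ, 0 < a₀ → ∃ γ₀ ε₂₉ β' : ℝ, 0 < γ₀ ∧ 0 < ε₂₉ ∧ ∀ (j : ℕ) (ε₀ B₃ B₃' a₁ : ℝ),
      BetaLowerH (-β') γ₀ (betaOfRecord₁₃ F 2 (theta13OfThm1CCMWZB F 2 j (1 / 2) a₀ ε₀ ε₂₉ B₃ B₃' a₀ a₁ (fun _ _ => 0) (fun _ _ => 0))) ∧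
      BetaUpperH β' γ₀ (betaOfRecord₁₃ F 2 (theta13OfThm1CCMWZB F 2 j (1 / 2) a₀ ε₀ ε₂₉ B₃ B₃' a₀ a₁ (fun _ _ => 0) (fun _ _ => 0))) := by
  refine tokenFreeZB_of_windowBoxAtZB F fun a₀ ha₀ => ?_
  obtain ⟨γ₀, ε₂₉, j, ε₀, B₃, B₃', a₁, Efl, logz, κ, C₉, ω, Λ, hγ₀, hγhalf, hε', hκ, hω0, hω1, hlim, h9w, hΛ, hdecw⟩ := h a₀ ha₀
  have hγθ : (theta13OfThm1CCMWZB F 2 j γ₀ a₀ ε₀ ε₂₉ B₃ B₃' a₀ a₁ Efl logz).γ = γ₀ := theta13OfThm1CCMWZB_γ F 2 j γ₀ a₀ ε₀ ε₂₉ B₃ B₃' a₀ a₁ Efl logz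
  have hγpos : 0 < (theta13OfThm1CCMWZB F 2 j γ₀ a₀ ε₀ ε₂₉ B₃ B₃' a₀ a₁ Efl logz).γ := by rw [hγθ]; exact hγ₀
  obtain ⟨β', -, hlow, hup⟩ := exists_absBetaBox_of_W1Letters F 2 _ hκ hγpos hlim h9w hΛ hω0 hω1 hdecw
  rw [hγθ] at hlow hup
  exact ⟨γ₀, ε₂₉, β', j, ε₀, B₃, B₃', a₁, Efl, logz, hγ₀, hγhalf, hε', hlow, hup⟩

end ZB

end Summit.QuantumFields.YangMills.Theorems.K0V23Stub3BoxSuppliers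

end
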